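import Summits.Ventures.PercRepro.C026PinnedN
import Summits.Ventures.PercRepro.C026GluingSigma

/-!
# The pin package on a family of branches glued at `a, b, c, x` (p6, gen 9)

mine-3's §27.14 Corollary 1 in its literal shape: a family `G i : MultiGraph V (E i)` of branches put
side by side (`sigmaGraph`, edges `Σ i, E i`) that share only the terminals `a, b, c, x`
(`SharesOnlyTerminals`) is a 4-terminal gluing coloured by the index (`isGluing4N_sigma`), so the
package `P(x) = [D_K(x) ≥ 0 ∧ Δ_{R→K}(x) ≥ 0]` on every branch gives it on the union
(`pinPackage_sigma`, from `pinPackage_of_gluing4N`).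
-/

namespace PercRepro

namespace MultiGraph

section PinnedSigma

variable {V ι : Type*} {E : ι → Type*}

/-- **The members share only the terminals `a, b, c, x`**: every other vertex carries edges of at most
one member of the family. -/
def SharesOnlyTerminals (G : ∀ i, MultiGraph V (E i)) (a b c x : V) : Prop :=
  ∀ v, v ≠ a → v ≠ b → v ≠ c → v ≠ x → ∀ i j (e : E i) (e' : E j), (G i).EdgeAt e v →
    (G j).EdgeAt e' v → i = j

/-- `SharesOnlyTerminals` is decidable on finite types (through `decidableSharesAt`). -/
instance decidableSharesOnlyTerminals [Fintype V] [Fintype ι] [DecidableEq V] [DecidableEq ι]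
    [∀ i, Fintype (E i)] (G : ∀ i, MultiGraph V (E i)) (a b c x : V) :
    Decidable (SharesOnlyTerminals G a b c x) := by
  unfold SharesOnlyTerminals
  infer_instance

/-- A family sharing only the terminals is an `ι`-coloured 4-terminal gluing, coloured by the index. -/
theorem isGluing4N_sigma {G : ∀ i, MultiGraph V (E i)} {a b c x : V}
    (h : SharesOnlyTerminals G a b c x) : (sigmaGraph G).IsGluing4N a b c x Sigma.fst :=
  fun v hva hvb hvc hvx e e' he he' => h v hva hvb hvc hvx e.1 e'.1 e.2 e'.2 he he'

/-- **§27.14 Corollary 1, literal form: the pin package on every branch of a family sharing only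
`a, b, c, x` gives it on the union** — in particular `D_K(x) ≥ 0` there. -/
theorem pinPackage_sigma [Fintype ι] [DecidableEq ι] [∀ i, Fintype (E i)] [∀ i, DecidableEq (E i)]
    (G : ∀ i, MultiGraph V (E i)) (a b c x : V) (hab : a ≠ b) (hac : a ≠ c) (hbc : b ≠ c)
    (hxa : x ≠ a) (hxb : x ≠ b) (hxc : x ≠ c) (hshare : SharesOnlyTerminals G a b c x)
    (h : ∀ i, (G i).PinPackage a b c x) : (sigmaGraph G).PinPackage a b c x :=
  pinPackage_of_gluing4N _ a b c x hab hac hbc hxa hxb hxc Sigma.fst (isGluing4N_sigma hshare)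
    fun i => pinPackage_of_edgeEquiv (ε := (sigmaColEquiv i).symm) (fun _ => rfl) (fun _ => rfl) (h i)

end PinnedSigma

end MultiGraph

end PercRepro
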